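import Literature.NumberTheory.ComplexMultiplication.ReflexTypeNormInclusion
import HarnessLib

/-!
# The reflex inclusion read in a big normal field: `φ(g(𝔞)) ⊆ 𝔓_M` for every `φ : K → M` in the type
# (Shimura 1998, §13.1–§13.2: «we extend the `ψ_α` to isomorphisms of `k` onto subfields of `ℚ̄`»)

Topic `Literature/NumberTheory/ComplexMultiplication`, namespace `Literature.NumberTheory.ComplexMultiplication`.
Cell `hodgecm-mathlib` (D-0151), fan B-II, E2 background programme (A-p02, `ROAD-E2-heightOne-S2degOne.md` §1 S3 /
§2 P1), consumer glue for the reflex-inclusion brick `ReflexTypeNormInclusion.lean`.  Theorems only; no definition,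
no named fact, no `sorry`.

## Why

The hypothesis `_h𝔮` of `shimuraTaniyamaPair_degOne'` (`ShimuraTaniyamaPairDegOne.lean`) binds ITS OWN normal number
field `Lg` with `ι : Lg → ℂ`, `j : K → Lg`, `σ₀ : K* → Lg` and asserts `IsReflexTypeNorm (valuedIn ι Φ) j σ₀ 𝔭 𝔮`.
The height-one argument (Shimura pp. 127–128, proof of Thm. 18.6 / §13.2 pp. 99–100) reads the CM type modulo a prime of a BIGGER normal field
`M ⊇ k, ι(Lg), φ(K)` (a common field, cf. `MainTheoremCMLevelCommonField.lean`): one needs «`φ(α) ∈ 𝔓_M` for every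
`α ∈ 𝔮 = g(𝔭)` and every `φ : K → M` whose complex shadow lies in `Φ`».  This file supplies exactly that, from
`IsReflexTypeNorm.mapRingHom_mem` (read in `Lg`) and the elementary fact that every embedding of `K` into an overfield
`M ⊇ ι'(Lg)` factors through the NORMAL field `Lg ⊇ j(K)`.

## What is here (all proved)

* §1 `exists_ringHom_comp_eq_of_normal` — `L/ℚ` normal, `j : K → L`, `ι' : L → M`: every `φ' : K → M` is `ι' ∘ φ`
  for a (unique) `φ : K → L` (the conjugates of `j(K)` in `M` lie in the normal subfield `ι'(L)`: the minimal
  polynomial of `j y` splits in `L`, so its roots in `M` are images of roots in `L`); `ringHom_comp_injective`.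
* §2 `image_comp_valuedIn_eq` — the type read in `L` and in `M` correspond: `ι' ∘ (valuedIn ι Φ) = valuedIn ιM Φ`
  for `ιM ∘ ι' = ι`.
* §3 **`IsReflexTypeNorm.mapRingHom_mem_overfield`** (`𝔞^{ι'σ₀}𝔬_M ⊆ 𝔓 → φ' = ι' ∘ φ, φ ∈ Φ → α ∈ 𝔟 → φ'(α) ∈ 𝔓`),
  its `comap` form, and the CM spelling **`IsReflexTypeNorm.mapRingHom_mem_overfield_of_comp_mem`**
  (`IsReflexTypeNorm (valuedIn ι Φc) j σ₀ 𝔞 𝔟 → ιM ∘ ι' = ι → 𝔞^{ι'σ₀}𝔬_M ⊆ 𝔓 → ιM ∘ φ' ∈ Φc → α ∈ 𝔟 → φ'(α) ∈ 𝔓`),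
  plus the ideal form `IsReflexTypeNorm.map_le_of_comp_mem_overfield`.

## References

* [Shimura1998] G. Shimura, *Abelian Varieties with Complex Multiplication and Modular Functions*, Princeton 1998:
  §13.1 (p. 96, before (1): «We extend the `ψ_α` to isomorphisms of `k` onto subfields of `ℚ̄`»; (1), (7));
  §13.2 (pp. 99–100); §18.6, proof of Thm. 18.6, reduction modulo 𝔓 passage (pp. 127–128).
* [Lang2002] S. Lang, *Algebra*, 3rd ed., GTM 211, Ch. V §3, Thm. 3.3 (normal extensions: embeddings over `k` of a
  subfield into an algebraic closure map into the normal extension).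
-/

noncomputable section

open scoped NumberField Pointwise
open NumberField

namespace Literature.NumberTheory.ComplexMultiplication

/-! ## §1. Embeddings of a subfield of a normal field into an overfield factor through the normal field -/

section Factor

variable {K L M : Type*} [Field K] [Field L] [Field M]

/-- Restricting a composite of field embeddings to rings of integers is the composite of the restrictions.
[folklore] -/
private theorem mapRingHom_comp_mapRingHom' (f : K →+* L) (g : L →+* M) :
    (RingOfIntegers.mapRingHom g).comp (RingOfIntegers.mapRingHom f) = RingOfIntegers.mapRingHom (g.comp f) :=
  RingHom.ext fun _ => RingOfIntegers.ext rfl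

/-- Composition with a field embedding `ι' : L → M` is injective on embeddings `K → L`. [folklore] -/
private theorem ringHom_comp_injective (ι' : L →+* M) :
    Function.Injective (fun φ : K →+* L => ι'.comp φ) := fun φ₁ φ₂ h =>
  RingHom.ext fun x => ι'.injective (by simpa using RingHom.congr_fun h x)

variable [CharZero K] [CharZero L] [CharZero M]

/-- **Every embedding of `K` into an overfield of a NORMAL field `L ⊇ j(K)` lands in `L`**: for `L/ℚ` normal,
`j : K → L`, `ι' : L → M` and any `φ' : K → M`, every `φ'(y)` lies in `ι'(L)` — it is a root of the minimal
polynomial of `j(y)` over `ℚ`, which splits in `L`, so its roots in `M` are the images of its roots in `L`.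
(Lang: an embedding of an intermediate field of a normal extension into an algebraic closure maps into the normal
extension.) [cite: Lang2002, Ch. V §3, Thm. 3.3] -/
theorem apply_mem_range_of_normal [Normal ℚ L] (j : K →+* L) (ι' : L →+* M) (φ' : K →+* M) (y : K) :
    φ' y ∈ ι'.range := by
  have hint : IsIntegral ℚ (j y) := Algebra.IsIntegral.isIntegral (j y)
  have hsplit : ((minpoly ℚ (j y)).map (algebraMap ℚ L)).Splits := Normal.splits inferInstance (j y)
  have hp0 : (minpoly ℚ (j y)).map (algebraMap ℚ L) ≠ 0 :=
    (Polynomial.map_ne_zero_iff (algebraMap ℚ L).injective).2 (minpoly.ne_zero hint)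
  refine hsplit.mem_range_of_isRoot hp0 ?_
  rw [Polynomial.map_map, RingHom.ext_rat (ι'.comp (algebraMap ℚ L)) (algebraMap ℚ M), Polynomial.IsRoot.def,
    Polynomial.eval_map, ← Polynomial.aeval_def,
    show j y = j.toRatAlgHom y from rfl, minpoly.algHom_eq j.toRatAlgHom j.injective y,
    show φ' y = φ'.toRatAlgHom y from rfl, Polynomial.aeval_algHom_apply, minpoly.aeval, map_zero]

/-- **Factorisation through the normal field**: for `L/ℚ` normal, `j : K → L` and `ι' : L → M`, every embedding
`φ' : K → M` is `ι' ∘ φ` for some embedding `φ : K → L` («we extend the `ψ_α` to isomorphisms of `k` onto subfields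
of `ℚ̄`, which we denote again by `ψ_α`» — conversely every such isomorphism comes from one into the normal field).
[cite: Lang2002, Ch. V §3, Thm. 3.3] [cite: Shimura1998, §13.1, p. 96] -/
theorem exists_ringHom_comp_eq_of_normal [Normal ℚ L] (j : K →+* L) (ι' : L →+* M) (φ' : K →+* M) :
    ∃ φ : K →+* L, ι'.comp φ = φ' := by
  have key : ∀ y : K, ∃ x : L, ι' x = φ' y := fun y =>
    RingHom.mem_range.1 (apply_mem_range_of_normal j ι' φ' y)
  choose g hg using key
  refine ⟨{ toFun := g
            map_one' := ι'.injective (by rw [hg, map_one, map_one])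
            map_mul' := fun a b => ι'.injective (by rw [hg, map_mul, map_mul, hg, hg])
            map_zero' := ι'.injective (by rw [hg, map_zero, map_zero])
            map_add' := fun a b => ι'.injective (by rw [hg, map_add, map_add, hg, hg]) }, ?_⟩
  exact RingHom.ext fun y => hg y

/-- Uniqueness in the factorisation: `∃! φ : K → L, ι' ∘ φ = φ'`. [cite: Lang2002, Ch. V §3, Thm. 3.3] -/
theorem existsUnique_ringHom_comp_eq_of_normal [Normal ℚ L] (j : K →+* L) (ι' : L →+* M) (φ' : K →+* M) :
    ∃! φ : K →+* L, ι'.comp φ = φ' := by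
  obtain ⟨φ, hφ⟩ := exists_ringHom_comp_eq_of_normal j ι' φ'
  exact ⟨φ, hφ, fun ψ hψ => ringHom_comp_injective ι' (hψ.trans hφ.symm)⟩

/-- The embeddings `K → M` are exactly the `ι' ∘ φ`, `φ : K → L` (`L/ℚ` normal containing `j(K)`, `ι' : L → M`).
[cite: Lang2002, Ch. V §3, Thm. 3.3] -/
theorem range_comp_eq_univ_of_normal [Normal ℚ L] (j : K →+* L) (ι' : L →+* M) :
    Set.range (fun φ : K →+* L => ι'.comp φ) = Set.univ :=
  Set.eq_univ_of_forall fun φ' => exists_ringHom_comp_eq_of_normal j ι' φ'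

end Factor

/-! ## §2. The type read in `L` and in the overfield `M` -/

section ValuedIn

variable {K L M : Type*} [Field K] [Field L] [Field M] [CharZero K] [CharZero L] [CharZero M]

omit [CharZero K] [CharZero L] [CharZero M] in
/-- `ι' ∘ (valuedIn ι Φ) ⊆ valuedIn ιM Φ` when `ιM ∘ ι' = ι` (no normality needed). [cite: Shimura1998, §13.1, p. 96] -/
theorem image_comp_valuedIn_subset {ι : L →+* ℂ} {ι' : L →+* M} {ιM : M →+* ℂ} (hι : ιM.comp ι' = ι)
    (Φc : Set (K →+* ℂ)) : (fun φ : K →+* L => ι'.comp φ) '' valuedIn ι Φc ⊆ valuedIn ιM Φc := by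
  rintro _ ⟨φ, hφ, rfl⟩
  show ιM.comp (ι'.comp φ) ∈ Φc
  rw [← RingHom.comp_assoc, hι]
  exact hφ

/-- **The type read in `L` and in `M` correspond**: for `L/ℚ` normal with `j : K → L`, `ι' : L → M` and complex
embeddings `ιM ∘ ι' = ι`, the embeddings `K → M` whose complex shadow lies in `Φ` are exactly the `ι' ∘ φ` with
`φ ∈ valuedIn ι Φ` (Shimura reads the type in any subfield of `ℚ̄` large enough). [cite: Shimura1998, §13.1, p. 96] -/
theorem image_comp_valuedIn_eq [Normal ℚ L] (j : K →+* L) {ι : L →+* ℂ} {ι' : L →+* M} {ιM : M →+* ℂ}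
    (hι : ιM.comp ι' = ι) (Φc : Set (K →+* ℂ)) :
    (fun φ : K →+* L => ι'.comp φ) '' valuedIn ι Φc = valuedIn ιM Φc := by
  refine Set.Subset.antisymm (image_comp_valuedIn_subset hι Φc) fun φ' hφ' => ?_
  obtain ⟨φ, rfl⟩ := exists_ringHom_comp_eq_of_normal j ι' φ'
  refine ⟨φ, ?_, rfl⟩
  show ι.comp φ ∈ Φc
  rw [← hι, RingHom.comp_assoc]
  exact hφ'

/-- Membership form: `ιM ∘ φ' ∈ Φ ↔ ∃ φ ∈ valuedIn ι Φ, ι' ∘ φ = φ'`. [cite: Shimura1998, §13.1, p. 96] -/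
theorem mem_valuedIn_iff_exists_comp_eq [Normal ℚ L] (j : K →+* L) {ι : L →+* ℂ} {ι' : L →+* M}
    {ιM : M →+* ℂ} (hι : ιM.comp ι' = ι) (Φc : Set (K →+* ℂ)) (φ' : K →+* M) :
    φ' ∈ valuedIn ιM Φc ↔ ∃ φ ∈ valuedIn ι Φc, ι'.comp φ = φ' := by
  rw [← image_comp_valuedIn_eq j hι Φc, Set.mem_image]

end ValuedIn

/-! ## §3. The reflex inclusion read modulo an ideal of the big field -/

section Overfield

variable {K k L M : Type*} [Field K] [CharZero K] [Field k] [NumberField k] [Field L] [NumberField L]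
  [Normal ℚ L] [Field M]

/-- **The reflex inclusion read in an overfield**: if `j(𝔟)𝔬_L = ∏_{σ ∈ Ψ_j} 𝔞^σ𝔬_L` in the normal field `L`
(`𝔟 = g(𝔞)`), `ι' : L → M`, and `𝔓` is an ideal of `𝔬_M` containing `𝔞^{ι' ∘ σ₀}𝔬_M` (e.g. a prime of `M` above
`σ₀(𝔞)`), then `φ'(α) ∈ 𝔓` for every `α ∈ 𝔟` and every embedding `φ' = ι' ∘ φ : K → M` with `φ ∈ Φ` — the
inclusion `φ(𝔟)𝔬_L ⊆ 𝔞^{σ₀}𝔬_L` (`IsReflexTypeNorm.mapRingHom_mem`) read modulo `ι'⁻¹(𝔓)`.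
[cite: Shimura1998, §13.2, pp. 99–100; §18.6, proof of Thm. 18.6 (reduction modulo 𝔓 passage), pp. 127–128] -/
theorem IsReflexTypeNorm.mapRingHom_mem_overfield {Φ : Set (K →+* L)} {j : K →+* L} {σ₀ : k →+* L}
    {𝔞 : Ideal (𝓞 k)} {𝔟 : Ideal (𝓞 K)} (h : IsReflexTypeNorm Φ j σ₀ 𝔞 𝔟) (ι' : L →+* M) {𝔓 : Ideal (𝓞 M)}
    (h𝔓 : 𝔞.map (RingOfIntegers.mapRingHom (ι'.comp σ₀)) ≤ 𝔓) {φ' : K →+* M} (hφ' : ∃ φ ∈ Φ, ι'.comp φ = φ')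
    {α : 𝓞 K} (hα : α ∈ 𝔟) : RingOfIntegers.mapRingHom φ' α ∈ 𝔓 := by
  obtain ⟨φ, hφ, rfl⟩ := hφ'
  have h1 : 𝔞.map (RingOfIntegers.mapRingHom σ₀) ≤ 𝔓.comap (RingOfIntegers.mapRingHom ι') := by
    rw [← Ideal.map_le_iff_le_comap, Ideal.map_map, mapRingHom_comp_mapRingHom']
    exact h𝔓
  have h2 := h.mapRingHom_mem hφ h1 hα
  rw [Ideal.mem_comap] at h2
  exact h2

/-- The same with `𝔓` given by its contraction to `k` along `ι' ∘ σ₀`: `𝔞 ⊆ (ι' ∘ σ₀)⁻¹(𝔓)` (e.g.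
`𝔓 ∩ 𝔬_k = 𝔞` for a prime `𝔓` of `M` over the prime `𝔞`). [cite: Shimura1998, §13.2, pp. 99–100] -/
theorem IsReflexTypeNorm.mapRingHom_mem_overfield_of_le_comap {Φ : Set (K →+* L)} {j : K →+* L} {σ₀ : k →+* L}
    {𝔞 : Ideal (𝓞 k)} {𝔟 : Ideal (𝓞 K)} (h : IsReflexTypeNorm Φ j σ₀ 𝔞 𝔟) (ι' : L →+* M) {𝔓 : Ideal (𝓞 M)}
    (h𝔓 : 𝔞 ≤ 𝔓.comap (RingOfIntegers.mapRingHom (ι'.comp σ₀))) {φ' : K →+* M}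
    (hφ' : ∃ φ ∈ Φ, ι'.comp φ = φ') {α : 𝓞 K} (hα : α ∈ 𝔟) : RingOfIntegers.mapRingHom φ' α ∈ 𝔓 :=
  h.mapRingHom_mem_overfield ι' (Ideal.map_le_iff_le_comap.2 h𝔓) hφ' hα

/-- Ideal form in the overfield: `φ'(𝔟)𝔬_M ⊆ 𝔞^{ι' ∘ σ₀}𝔬_M` for `φ' = ι' ∘ φ`, `φ ∈ Φ`.
[cite: Shimura1998, §13.2, pp. 99–100] -/
theorem IsReflexTypeNorm.map_le_map_overfield {Φ : Set (K →+* L)} {j : K →+* L} {σ₀ : k →+* L}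
    {𝔞 : Ideal (𝓞 k)} {𝔟 : Ideal (𝓞 K)} (h : IsReflexTypeNorm Φ j σ₀ 𝔞 𝔟) (ι' : L →+* M) {φ' : K →+* M}
    (hφ' : ∃ φ ∈ Φ, ι'.comp φ = φ') :
    𝔟.map (RingOfIntegers.mapRingHom φ') ≤ 𝔞.map (RingOfIntegers.mapRingHom (ι'.comp σ₀)) := by
  obtain ⟨φ, hφ, rfl⟩ := hφ'
  rw [← mapRingHom_comp_mapRingHom' φ ι', ← mapRingHom_comp_mapRingHom' σ₀ ι', ← Ideal.map_map,
    ← Ideal.map_map]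
  exact Ideal.map_mono (h.map_le_map hφ)

variable [CharZero M]

/-- **Reflex inclusion, CM-type spelling in a big normal field** (the form the height-one argument consumes):
`IsReflexTypeNorm (valuedIn ι Φ) j σ₀ 𝔞 𝔟` read in the normal field `L` (the `_h𝔮` clause of
`shimuraTaniyamaPair_degOne'`, `𝔞 := 𝔭`, `𝔟 := 𝔮 = g(𝔭)`), an overfield `ι' : L → M` with compatible complex
embeddings `ιM ∘ ι' = ι`, and an ideal `𝔓 ⊇ 𝔞^{ι' ∘ σ₀}𝔬_M` of `𝔬_M` give `φ'(α) ∈ 𝔓` for EVERY `α ∈ 𝔟` and EVERY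
`φ' : K → M` with `ιM ∘ φ' ∈ Φ` — «every `φ ∈ Φ` has `φ(α) ∈ φ(𝔮) ⊆ 𝔓̃`», whence `Lie(ι̃(α)) = 0` on the `Φ`-eigenlines
of the reduction. [cite: Shimura1998, §13.2, pp. 99–100; §18.6, proof of Thm. 18.6 (reduction modulo 𝔓 passage), pp. 127–128] -/
theorem IsReflexTypeNorm.mapRingHom_mem_overfield_of_comp_mem {Φc : Set (K →+* ℂ)} {ι : L →+* ℂ} {j : K →+* L}
    {σ₀ : k →+* L} {𝔞 : Ideal (𝓞 k)} {𝔟 : Ideal (𝓞 K)} (h : IsReflexTypeNorm (valuedIn ι Φc) j σ₀ 𝔞 𝔟)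
    {ι' : L →+* M} {ιM : M →+* ℂ} (hι : ιM.comp ι' = ι) {𝔓 : Ideal (𝓞 M)}
    (h𝔓 : 𝔞.map (RingOfIntegers.mapRingHom (ι'.comp σ₀)) ≤ 𝔓) {φ' : K →+* M} (hφ' : ιM.comp φ' ∈ Φc) {α : 𝓞 K}
    (hα : α ∈ 𝔟) : RingOfIntegers.mapRingHom φ' α ∈ 𝔓 :=
  h.mapRingHom_mem_overfield ι' h𝔓 ((mem_valuedIn_iff_exists_comp_eq j hι Φc φ').1 hφ') hα

/-- The same with `𝔓` given by `𝔞 ⊆ (ι' ∘ σ₀)⁻¹(𝔓)`.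
[cite: Shimura1998, §13.2, pp. 99–100; §18.6, proof of Thm. 18.6 (reduction modulo 𝔓 passage), pp. 127–128] -/
theorem IsReflexTypeNorm.mapRingHom_mem_overfield_of_comp_mem_of_le_comap {Φc : Set (K →+* ℂ)} {ι : L →+* ℂ}
    {j : K →+* L} {σ₀ : k →+* L} {𝔞 : Ideal (𝓞 k)} {𝔟 : Ideal (𝓞 K)}
    (h : IsReflexTypeNorm (valuedIn ι Φc) j σ₀ 𝔞 𝔟) {ι' : L →+* M} {ιM : M →+* ℂ} (hι : ιM.comp ι' = ι)
    {𝔓 : Ideal (𝓞 M)} (h𝔓 : 𝔞 ≤ 𝔓.comap (RingOfIntegers.mapRingHom (ι'.comp σ₀))) {φ' : K →+* M}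
    (hφ' : ιM.comp φ' ∈ Φc) {α : 𝓞 K} (hα : α ∈ 𝔟) : RingOfIntegers.mapRingHom φ' α ∈ 𝔓 :=
  h.mapRingHom_mem_overfield_of_comp_mem hι (Ideal.map_le_iff_le_comap.2 h𝔓) hφ' hα

/-- Ideal form of the CM spelling: `φ'(𝔟)𝔬_M ⊆ 𝔞^{ι' ∘ σ₀}𝔬_M` for every `φ' : K → M` with `ιM ∘ φ' ∈ Φ`.
[cite: Shimura1998, §13.2, pp. 99–100] -/
theorem IsReflexTypeNorm.map_le_map_overfield_of_comp_mem {Φc : Set (K →+* ℂ)} {ι : L →+* ℂ} {j : K →+* L}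
    {σ₀ : k →+* L} {𝔞 : Ideal (𝓞 k)} {𝔟 : Ideal (𝓞 K)} (h : IsReflexTypeNorm (valuedIn ι Φc) j σ₀ 𝔞 𝔟)
    {ι' : L →+* M} {ιM : M →+* ℂ} (hι : ιM.comp ι' = ι) {φ' : K →+* M} (hφ' : ιM.comp φ' ∈ Φc) :
    𝔟.map (RingOfIntegers.mapRingHom φ') ≤ 𝔞.map (RingOfIntegers.mapRingHom (ι'.comp σ₀)) :=
  h.map_le_map_overfield ι' ((mem_valuedIn_iff_exists_comp_eq j hι Φc φ').1 hφ')

end Overfield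

end Literature.NumberTheory.ComplexMultiplication

end
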